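import Summits.ResolutionOfSingularities.ResolutionOfSingularities.Theorems.FrobeniusLadderFInjectiveMacaulayficationToricChartFedder
import Summits.ResolutionOfSingularities.ResolutionOfSingularities.Theorems.FrobeniusLadderFInjectiveMacaulayficationMonomialChartFrobeniusTransport
import Mathlib.RingTheory.MvPolynomial.Tower
import HarnessLib

/-!
# The toric chart Fedder theorem (idea-2's `toricChart_fedder`), assembled

[OURS · L1 W4.5a] Support file for crux stmt-ResolutionOfSingularities-15315
(`Summit.ResolutionOfSingularities.ResolutionOfSingularities.Theses.FrobeniusLadder.FInjectiveMacaulayfication`, route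
`FrobeniusLadder`, skeleton v11 `86e9127b5c98b8e6`).  Seat table v5 (stub-1 (b)): **the Cartier–Newton CHART THEOREM in Fedder form**
(idea-2 `toricChart_fedder`, `L/res-L1-w45a-idea-2/Sketch-L1-idea-2.lean` v2, the engine of both surviving cards — hole #4 class CN and
hole #3 strata), PROVED with the cards' abbreviations `FedderAt` / `FaceFPure` / `IsInitialDegree` unfolded (idea-2's statement follows
by `exact`).  Data: `V` a unimodular exponent matrix, `θ : X_j ↦ ∏ᵢ Yᵢ ^ V i j`, `θ f = Y^d · g`, a `K`-point `a` of the strict transform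
`g` with vanishing exceptional coordinates `S ≠ ∅` (`aᵢ = 0 ↔ i ∈ S`), face compatibility (some monomial of `f` attains
`(V·m)ᵢ = dᵢ` for all `i ∈ S`), and the face of `f` cut out by `w = Σ_{i∈S} vᵢ` F-pure on the torus.  Conclusion: `g` passes Fedder's
non-membership test at `a`.  Chain: `D = Σ_{i∈S} dᵢ` is the initial degree and `Y^d · g(Y_S=0) = θ(in_w f)` (B4 `ToricChartFedder`);
at the torus point `ã` (`ãᵢ = 1` on `S`, `= aᵢ` off `S`) and `b = ã^V`: face F-purity gives Fedder for `in_w f` at `b` (the face vanishes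
there since `g(a) = 0`), B3 `MonomialChartFrobeniusTransport` moves it to `θ(in_w f) = Y^d · g(Y_S=0)` at `ã`, B2 `FedderPointReductions`
removes `Y^d`, B1 moves `g(Y_S=0)` from `ã` to `a` and lifts to `g`.  No definition is declared; AI-written, weaker than expert review; no
statement of [claim: Hironaka2017] is used. [folklore; cite: Fedder1983, Prop. 1.7 (the test)]
-/

-- single-problem summit: the doubled namespace component is forced
set_option linter.dupNamespace false

noncomputable section

namespace Summit.ResolutionOfSingularities.ResolutionOfSingularities.Theorems.FInjectiveMacaulayfication.ToricChartFedderAssembly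

open MvPolynomial
open Summit.ResolutionOfSingularities.ResolutionOfSingularities.Theorems.FInjectiveMacaulayfication

variable {n : ℕ}

/-- The chart map commutes with base change. [folklore] -/
theorem map_theta {k K : Type} [CommRing k] [CommRing K] (φ : k →+* K) (V : Matrix (Fin n) (Fin n) ℕ)
    (q : MvPolynomial (Fin n) k) :
    map φ (aeval (fun j : Fin n => ∏ i : Fin n, (X i : MvPolynomial (Fin n) k) ^ V i j) q) =
      aeval (fun j : Fin n => ∏ i : Fin n, (X i : MvPolynomial (Fin n) K) ^ V i j) (map φ q) := by
  have h : (map φ).comp (aeval (fun j : Fin n => ∏ i : Fin n, (X i : MvPolynomial (Fin n) k) ^ V i j)).toRingHom =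
      (aeval (fun j : Fin n => ∏ i : Fin n, (X i : MvPolynomial (Fin n) K) ^ V i j)).toRingHom.comp (map φ) := by
    refine ringHom_ext (fun c => ?_) (fun j => ?_)
    · simp only [RingHom.comp_apply, AlgHom.toRingHom_eq_coe, AlgHom.coe_toRingHom, algHom_C, algebraMap_eq, map_C]
    · simp only [RingHom.comp_apply, AlgHom.toRingHom_eq_coe, AlgHom.coe_toRingHom, aeval_X, map_X, map_prod, map_pow]
  exact DFunLike.congr_fun h q

/-- Setting the `S`-coordinates to zero commutes with base change. [folklore] -/
theorem map_substZero {k K : Type} [CommRing k] [CommRing K] (φ : k →+* K) (S : Finset (Fin n))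
    (q : MvPolynomial (Fin n) k) :
    map φ (aeval (fun i : Fin n => if i ∈ S then (0 : MvPolynomial (Fin n) k) else X i) q) =
      aeval (fun i : Fin n => if i ∈ S then (0 : MvPolynomial (Fin n) K) else X i) (map φ q) := by
  have h : (map φ).comp (aeval (fun i : Fin n => if i ∈ S then (0 : MvPolynomial (Fin n) k) else X i)).toRingHom =
      (aeval (fun i : Fin n => if i ∈ S then (0 : MvPolynomial (Fin n) K) else X i)).toRingHom.comp (map φ) := by
    refine ringHom_ext (fun c => ?_) (fun j => ?_)
    · simp only [RingHom.comp_apply, AlgHom.toRingHom_eq_coe, AlgHom.coe_toRingHom, algHom_C, algebraMap_eq, map_C]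
    · simp only [RingHom.comp_apply, AlgHom.toRingHom_eq_coe, AlgHom.coe_toRingHom, aeval_X, map_X]
      split_ifs
      · rw [map_zero]
      · rw [map_X]
  exact DFunLike.congr_fun h q

/-- Evaluation after setting the `S`-coordinates to zero. [folklore] -/
theorem aeval_substZero {K : Type} [CommRing K] (S : Finset (Fin n)) (c : Fin n → K) (q : MvPolynomial (Fin n) K) :
    aeval c (aeval (fun i : Fin n => if i ∈ S then (0 : MvPolynomial (Fin n) K) else X i) q) =
      aeval (fun i : Fin n => if i ∈ S then (0 : K) else c i) q := by
  rw [← AlgHom.comp_apply, comp_aeval]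
  have h : (fun i : Fin n => aeval c (if i ∈ S then (0 : MvPolynomial (Fin n) K) else X i)) =
      fun i : Fin n => if i ∈ S then (0 : K) else c i := by
    funext i
    split_ifs
    · rw [map_zero]
    · rw [aeval_X]
  rw [h]

/-- Evaluation at `ã` after the chart map is evaluation at `b = ã^V`. [folklore] -/
theorem aeval_theta {K : Type} [Field K] (V : Matrix (Fin n) (Fin n) ℕ) (c : Fin n → K) (q : MvPolynomial (Fin n) K) :
    aeval c (aeval (fun j : Fin n => ∏ i : Fin n, (X i : MvPolynomial (Fin n) K) ^ V i j) q) =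
      aeval (fun j : Fin n => ∏ i : Fin n, c i ^ V i j) q := by
  rw [← AlgHom.comp_apply, comp_aeval]
  have h : (fun j : Fin n => aeval c (∏ i : Fin n, (X i : MvPolynomial (Fin n) K) ^ V i j)) =
      fun j : Fin n => ∏ i : Fin n, c i ^ V i j := by
    funext j
    exact MonomialChartFrobeniusTransport.aeval_chartMonomial V c j
  rw [h]

/-- The ideal of a `K`-point is maximal. [folklore] -/
theorem isMaximal_span_X_sub_C {K : Type} [Field K] (c : Fin n → K) :
    (Ideal.span (Set.range fun i : Fin n => X i - C (c i)) : Ideal (MvPolynomial (Fin n) K)).IsMaximal := by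
  have hker : RingHom.ker (aeval c : MvPolynomial (Fin n) K →ₐ[K] K).toRingHom =
      Ideal.span (Set.range fun i : Fin n => X i - C (c i)) := by
    apply le_antisymm
    · intro q hq
      exact MonomialChartFrobeniusTransport.mem_span_X_sub_C_of_aeval_eq_zero c q (by simpa using hq)
    · rw [Ideal.span_le]
      rintro _ ⟨i, rfl⟩
      rw [SetLike.mem_coe, RingHom.mem_ker]
      change aeval c (X i - C (c i)) = 0
      rw [map_sub, aeval_X, aeval_C, Algebra.algebraMap_self, RingHom.id_apply, sub_self]
  rw [← hker]
  exact RingHom.ker_isMaximal_of_surjective _ fun x => ⟨C x, by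
    change aeval c (C x) = x
    rw [aeval_C, Algebra.algebraMap_self, RingHom.id_apply]⟩

/-- **THE TORIC CHART FEDDER THEOREM** (idea-2 `toricChart_fedder`, abbreviations unfolded; see the module docstring). [folklore] -/
theorem toricChart_fedder (p : ℕ) [hp : Fact p.Prime] {k : Type} [Field k] [CharP k p]
    (f : MvPolynomial (Fin n) k) (V : Matrix (Fin n) (Fin n) ℕ)
    (hV : IsUnit (V.map (Nat.cast : ℕ → ℤ)).det)
    (d : Fin n →₀ ℕ) (g : MvPolynomial (Fin n) k)
    (hg : aeval (fun j : Fin n => ∏ i : Fin n, (X i : MvPolynomial (Fin n) k) ^ V i j) f = monomial d (1 : k) * g)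
    (K : Type) [Field K] [CharP K p] [Algebra k K] (a : Fin n → K)
    (S : Finset (Fin n)) (hS : ∀ i, i ∈ S ↔ a i = 0) (hSne : S.Nonempty)
    (hf : ∀ D : ℕ, (weightedHomogeneousComponent (fun j : Fin n => ∑ i ∈ S, V i j) D f ≠ 0 ∧
        ∀ D' < D, weightedHomogeneousComponent (fun j : Fin n => ∑ i ∈ S, V i j) D' f = 0) →
      ∀ (L : Type) [Field L] [Algebra k L] (c : Fin n → L), (∀ i, c i ≠ 0) →
        aeval c (weightedHomogeneousComponent (fun j : Fin n => ∑ i ∈ S, V i j) D f) = 0 →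
          (map (algebraMap k L) (weightedHomogeneousComponent (fun j : Fin n => ∑ i ∈ S, V i j) D f)) ^ (p - 1) ∉
            Ideal.span (Set.range fun i : Fin n => (X i - C (c i)) ^ p))
    (hface : ∃ m ∈ f.support, ∀ i ∈ S, ∑ j : Fin n, V i j * m j = d i)
    (ha : aeval a g = 0) :
    (map (algebraMap k K) g) ^ (p - 1) ∉ Ideal.span (Set.range fun i : Fin n => (X i - C (a i)) ^ p) := by
  classical
  have _ := hSne
  have hp0 : p ≠ 0 := hp.out.ne_zero
  -- notation
  set w : Fin n → ℕ := fun j => ∑ i ∈ S, V i j with hw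
  set D : ℕ := ∑ i ∈ S, d i with hD
  set P₀ : MvPolynomial (Fin n) k := weightedHomogeneousComponent w D f with hP₀
  set G : MvPolynomial (Fin n) K := map (algebraMap k K) g with hG
  set gS : MvPolynomial (Fin n) K :=
    aeval (fun i : Fin n => if i ∈ S then (0 : MvPolynomial (Fin n) K) else X i) G with hgS
  -- (B4) the initial degree and the chart identity, base-changed to `K`
  have hID := ToricChartFedder.isInitialDegree_face V hV f g d hg S hface
  have hident : monomial d (1 : K) * gS =
      aeval (fun j : Fin n => ∏ i : Fin n, (X i : MvPolynomial (Fin n) K) ^ V i j) (map (algebraMap k K) P₀) := by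
    have h := congrArg (map (algebraMap k K)) (ToricChartFedder.monomial_mul_substZero_eq_theta_component V hV f g d hg S)
    rw [map_mul, map_monomial, map_one, map_substZero, map_theta] at h
    exact h
  -- the torus point `ã` and its image `b`
  set at' : Fin n → K := fun i => if i ∈ S then (1 : K) else a i with hat
  have hat0 : ∀ i, at' i ≠ 0 := fun i => by
    by_cases hi : i ∈ S
    · rw [hat]; simp only [hi, if_true]; exact one_ne_zero
    · rw [hat]; simp only [hi, if_false]; exact fun h => hi ((hS i).mpr h)
  have hb0 : ∀ j, (∏ i : Fin n, at' i ^ V i j) ≠ 0 := fun j =>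
    Finset.prod_ne_zero_iff.mpr fun i _ => pow_ne_zero _ (hat0 i)
  -- `g(Y_S = 0)` evaluated at `ã` is `g(a) = 0`
  have hsub : (fun i : Fin n => if i ∈ S then (0 : K) else at' i) = a := by
    funext i
    by_cases hi : i ∈ S
    · rw [if_pos hi, ((hS i).mp hi)]
    · rw [if_neg hi, hat]; simp only [hi, if_false]
  have hgS_at : aeval at' gS = 0 := by
    rw [hgS, aeval_substZero, hsub, hG, aeval_map_algebraMap, ha]
  -- the face polynomial vanishes at `b`
  have hvan : aeval (fun j : Fin n => ∏ i : Fin n, at' i ^ V i j) P₀ = 0 := by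
    have h1 : aeval (fun j : Fin n => ∏ i : Fin n, at' i ^ V i j) (map (algebraMap k K) P₀) = 0 := by
      rw [← aeval_theta V at', ← hident, map_mul, hgS_at, mul_zero]
    rwa [aeval_map_algebraMap] at h1
  -- face F-purity at the torus point `b`
  have hfed_b := hf D hID K (fun j : Fin n => ∏ i : Fin n, at' i ^ V i j) hb0 hvan
  -- (B3) transport to `ã`
  have hfed_at := MonomialChartFrobeniusTransport.fedder_monomialChart_of_fedder p V hV at' hat0
    (map (algebraMap k K) P₀) hfed_b
  rw [← hident] at hfed_at
  -- (B2) remove the monomial factor `Y^d` (non-zero at `ã`)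
  haveI := isMaximal_span_X_sub_C at'
  have hmon : (monomial d (1 : K) : MvPolynomial (Fin n) K) ∉
      Ideal.span (Set.range fun i : Fin n => X i - C (at' i)) := by
    intro hmem
    have hz : aeval at' (monomial d (1 : K) : MvPolynomial (Fin n) K) = 0 := by
      have hle : Ideal.span (Set.range fun i : Fin n => X i - C (at' i)) ≤
          RingHom.ker (aeval at' : MvPolynomial (Fin n) K →ₐ[K] K).toRingHom := by
        rw [Ideal.span_le]
        rintro _ ⟨i, rfl⟩
        rw [SetLike.mem_coe, RingHom.mem_ker]
        change aeval at' (X i - C (at' i)) = 0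
        rw [map_sub, aeval_X, aeval_C, Algebra.algebraMap_self, RingHom.id_apply, sub_self]
      exact hle hmem
    rw [aeval_monomial, Algebra.algebraMap_self, RingHom.id_apply, one_mul,
      Finsupp.prod_fintype _ _ (fun i => by simp)] at hz
    exact Finset.prod_ne_zero_iff.mpr (fun i _ => pow_ne_zero _ (hat0 i)) hz
  have hfed_gS_at : gS ^ (p - 1) ∉ Ideal.span (Set.range fun i : Fin n => (X i - C (at' i)) ^ p) := fun hmem =>
    hfed_at ((FedderPointReductions.mul_pow_mem_frobeniusSpan_iff p hp0 at' _ rfl (monomial d (1 : K)) gS hmon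
      (p - 1)).mpr hmem)
  -- (B1) from `ã` to `a` (the `S`-coordinates are irrelevant for the `S`-free polynomial `g(Y_S = 0)`), then lift to `g`
  have hφa : (fun i : Fin n => if i ∈ S then C (a i) else (X i : MvPolynomial (Fin n) K)) =
      fun i : Fin n => if i ∈ S then (0 : MvPolynomial (Fin n) K) else X i := by
    funext i
    by_cases hi : i ∈ S
    · rw [if_pos hi, if_pos hi, (hS i).mp hi, map_zero]
    · rw [if_neg hi, if_neg hi]
  have hfix : aeval (fun i : Fin n => if i ∈ S then C (a i) else (X i : MvPolynomial (Fin n) K)) gS = gS := by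
    rw [hφa, hgS, ← AlgHom.comp_apply, comp_aeval]
    have h : (fun i : Fin n => aeval (fun i : Fin n => if i ∈ S then (0 : MvPolynomial (Fin n) K) else X i)
        (if i ∈ S then (0 : MvPolynomial (Fin n) K) else X i)) =
        fun i : Fin n => if i ∈ S then (0 : MvPolynomial (Fin n) K) else X i := by
      funext i
      by_cases hi : i ∈ S
      · simp only [hi, if_true, map_zero]
      · simp only [hi, if_false, aeval_X]
    rw [h]
  have hfed_gS_a : gS ^ (p - 1) ∉ Ideal.span (Set.range fun i : Fin n => (X i - C (a i)) ^ p) := fun hmem =>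
    hfed_gS_at (FedderPointReductions.pow_mem_frobeniusSpan_of_subst p hp0 S a a at' (fun _ _ => rfl)
      (fun i hi => by rw [hat]; simp only [hi, if_false]) gS (p - 1) hfix hmem)
  refine FedderPointReductions.faceFedder_lift_finset p hp0 S a G (p - 1) ?_
  rw [hφa, ← hgS]
  exact hfed_gS_a

end Summit.ResolutionOfSingularities.ResolutionOfSingularities.Theorems.FInjectiveMacaulayfication.ToricChartFedderAssembly

end
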